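import Summits.CriticalPhenomena.PercolationContinuityZ3.Theorems.PercNearOneGluingNoHeavyLowerTailAPLProfileRowPi
import Summits.CriticalPhenomena.PercolationContinuityZ3.Theorems.PercNearOneGluingNoHeavyLowerTailAPLProfileEdgeAnalytic
import Summits.CriticalPhenomena.PercolationContinuityZ3.Theorems.PercNearOneGluingNoHeavyLowerTailAPLProfile
import Summits.CriticalPhenomena.PercolationContinuityZ3.Theorems.PercNearOneGluingNoHeavyLowerTailAPLConjFForestCorollaries
import HarnessLib

/-!
# `NoHeavyLowerTail` (stmt-CriticalPhenomena-4575) — APL-P and APL(2/3) FOR EVERY FINITE WEIGHTED GRAPH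

Support file (prover prim-ineq-gen-8 gen 37; `--supports stmt-CriticalPhenomena-4575`; memo
run/shared/lean/prim/prim-ineq-gen-8/FINDING-gen37-APL-PROOF.md).  No definitions, no named facts, no sorries.

`μ = prodBernoulli w` on the pairs of a finite vertex type `V` (every pair `e` open independently with probability `w e ∈ [0,1]`),
three vertices `a, b, c`; `x ↔ y` = joined by an open path (`openConn`).
* **`profile_glued`** — for EVERY finite `S` and all `b, c`:  `μ(U_S)⁶ ≤ μ(A_S)²·μ(B_S)³·μ(C_S)³`
  (`U_S = {¬S~b, ¬S~c, b↮c}`, `A_S = {¬S~b, ¬S~c}`, `B_S = {¬S~b, b↮c}`, `C_S = {¬S~c, b↮c}`), by induction on the number of pairs of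
  positive weight: conditioning on one pair leaving `S` (`real_eq_pin_zero_add_pin_one`, `pin_one_*`), ROW Π, and LEMMA Q
  (`profile_edge_mixture`);
* **`profile_all`** — gen 31's PROFILE row APL-P for every finite weighted graph:
  `μ(a|b|c)⁶ ≤ μ(a∤bc)² · μ(b∤ac)³ · μ(c∤ab)³`, i.e. `P(a|b|c)³ ≤ P(a∤bc)·(P(b∤ac)P(c∤ab))^{3/2}`;
* **`apl23_all`** — **APL(2/3) for every finite weighted graph** (the conjecture of the APL lane, prove-5 g35 / FINAL-APL.md §7, with the
  sharp constant): in cells `u0 = μ(a|b|c)`, `uab = μ(ab|c)`, `uac = μ(ac|b)`, `u3 = μ(a↔b, a↔c)`: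
  `2·(u0+uab+uac)·(uab+uac+u3) ≤ 3·(uab+uac)`, i.e. `2·μ(b↮c)·μ(a↔b ∨ a↔c) ≤ 3·μ(a joined to exactly one of b, c)`:
  the increasing event `{a ↔ {b,c}}` and the decreasing event `{b ↮ c}` satisfy `P(A ∩ B) ≥ (2/3)·P(A)P(B)`;
* `apl1_twoThirds_all` — APL₁(2/3): `(2/3)·μ(a|b|c)·μ(a↔b, a↔c) ≤ μ(ab|c) + μ(ac|b)` (⟹ the APL₁(3/10) hypotheses of
  `ThreePort.pocketExchange_of_apl` on every finite weighted graph).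
[this work]
-/

noncomputable section

namespace Summit.CriticalPhenomena.PercolationContinuityZ3.Theorems

namespace APL

open MeasureTheory Set Literature.Probability.Percolation Literature.Probability.LatticeModels
open Literature.Probability.Percolation.KNPreFKG (openConn_symm)
open scoped Classical

variable {V : Type*} [Fintype V]

/-! ### The induction -/

/-- Support of the weights after pinning one positive pair to `0`. [folklore] -/
theorem support_pin_zero (w : Sym2 V → unitInterval) (e : Sym2 V) :
    (Finset.univ.filter fun f : Sym2 V => ¬ f.IsDiag ∧ 0 < (pinW w ({e} : Set (Sym2 V)) (∅ : Set (Sym2 V)) f : ℝ)) =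
      (Finset.univ.filter fun f : Sym2 V => ¬ f.IsDiag ∧ 0 < (w f : ℝ)).erase e := by
  ext f
  simp only [Finset.mem_filter, Finset.mem_univ, true_and, Finset.mem_erase]
  by_cases hf : f = e
  · subst hf
    rw [pinW_apply_of_mem_of_not_mem w (mem_singleton f) (notMem_empty f)]
    simp
  · rw [pinW_apply_of_not_mem w _ (show f ∉ ({e} : Set (Sym2 V)) from hf)]
    tauto

set_option maxHeartbeats 4000000 in
/-- **APL-P for every glued apex set** (memo §1).  For every weight function `w`, every finite set `S` of vertices and all `b, c`:
`μ(U_S)⁶ ≤ μ(A_S)² μ(B_S)³ μ(C_S)³`.  Induction on the number of non-loop pairs of positive weight. [this work] -/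
theorem profile_glued (b c : V) :
    ∀ (n : ℕ) (w : Sym2 V → unitInterval) (S : Finset V),
      (Finset.univ.filter fun f : Sym2 V => ¬ f.IsDiag ∧ 0 < (w f : ℝ)).card = n →
      (prodBernoulli w).real ((⋃ u ∈ (↑S : Set V), (openConn u b : Set (BondConfig V)))ᶜ
          ∩ (⋃ u ∈ (↑S : Set V), (openConn u c : Set (BondConfig V)))ᶜ ∩ (openConn b c : Set (BondConfig V))ᶜ) ^ 6 ≤
        (prodBernoulli w).real ((⋃ u ∈ (↑S : Set V), (openConn u b : Set (BondConfig V)))ᶜ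
            ∩ (⋃ u ∈ (↑S : Set V), (openConn u c : Set (BondConfig V)))ᶜ) ^ 2 *
          (prodBernoulli w).real ((⋃ u ∈ (↑S : Set V), (openConn u b : Set (BondConfig V)))ᶜ ∩ (openConn b c : Set (BondConfig V))ᶜ) ^ 3 *
          (prodBernoulli w).real ((⋃ u ∈ (↑S : Set V), (openConn u c : Set (BondConfig V)))ᶜ ∩ (openConn b c : Set (BondConfig V))ᶜ) ^ 3 := by
  intro n
  induction n using Nat.strong_induction_on with
  | _ n ih =>
  intro w S hcard
  -- (0) a target inside the glued set: the `U`-event is empty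
  by_cases hbS : b ∈ S
  · have hempty : ((⋃ u ∈ (↑S : Set V), (openConn u b : Set (BondConfig V)))ᶜ
        ∩ (⋃ u ∈ (↑S : Set V), (openConn u c : Set (BondConfig V)))ᶜ ∩ (openConn b c : Set (BondConfig V))ᶜ) = ∅ := by
      ext ω
      simp only [mem_inter_iff, mem_compl_iff, mem_iUnion, exists_prop, mem_empty_iff_false, iff_false, not_and, not_not]
      intro h
      exact absurd ⟨b, Finset.mem_coe.2 hbS, (SimpleGraph.Reachable.refl b : ω ∈ (openConn b b : Set (BondConfig V)))⟩ h.1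
    rw [hempty, measureReal_empty, zero_pow (by norm_num)]
    positivity
  by_cases hcS : c ∈ S
  · have hempty : ((⋃ u ∈ (↑S : Set V), (openConn u b : Set (BondConfig V)))ᶜ
        ∩ (⋃ u ∈ (↑S : Set V), (openConn u c : Set (BondConfig V)))ᶜ ∩ (openConn b c : Set (BondConfig V))ᶜ) = ∅ := by
      ext ω
      simp only [mem_inter_iff, mem_compl_iff, mem_iUnion, exists_prop, mem_empty_iff_false, iff_false, not_and, not_not]
      intro h
      exact absurd ⟨c, Finset.mem_coe.2 hcS, (SimpleGraph.Reachable.refl c : ω ∈ (openConn c c : Set (BondConfig V)))⟩ h.2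
    rw [hempty, measureReal_empty, zero_pow (by norm_num)]
    positivity
  by_cases hlive : ∃ s ∈ S, ∃ t, t ∉ S ∧ 0 < (w s(s, t) : ℝ)
  · -- (1) a live pair leaving `S`: condition on it
    obtain ⟨s, hs, t, ht, hpos⟩ := hlive
    have hst : s ≠ t := fun h => ht (h ▸ hs)
    have hed : ¬ (s(s, t)).IsDiag := by rwa [Sym2.mk_isDiag_iff]
    set w0 := pinW w ({s(s, t)} : Set (Sym2 V)) (∅ : Set (Sym2 V)) with hw0
    have hcard0 : (Finset.univ.filter fun f : Sym2 V => ¬ f.IsDiag ∧ 0 < (w0 f : ℝ)).card < n := by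
      rw [hw0, support_pin_zero w s(s, t), Finset.card_erase_of_mem, hcard]
      · have : 0 < n := by
          rw [← hcard]
          exact Finset.card_pos.2 ⟨s(s, t), Finset.mem_filter.2 ⟨Finset.mem_univ _, hed, hpos⟩⟩
        omega
      · exact Finset.mem_filter.2 ⟨Finset.mem_univ _, hed, hpos⟩
    have IH0 := ih _ hcard0 w0 S rfl
    have IH1 := ih _ hcard0 w0 (insert t S) rfl
    rw [Finset.coe_insert] at IH1
    -- the four decompositions `X = (1 - z) X₀ + z X₁`
    have eU := real_eq_pin_zero_add_pin_one w s(s, t) ((⋃ u ∈ (↑S : Set V), (openConn u b : Set (BondConfig V)))ᶜ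
        ∩ (⋃ u ∈ (↑S : Set V), (openConn u c : Set (BondConfig V)))ᶜ ∩ (openConn b c : Set (BondConfig V))ᶜ)
    have eA := real_eq_pin_zero_add_pin_one w s(s, t) ((⋃ u ∈ (↑S : Set V), (openConn u b : Set (BondConfig V)))ᶜ
        ∩ (⋃ u ∈ (↑S : Set V), (openConn u c : Set (BondConfig V)))ᶜ)
    have eB := real_eq_pin_zero_add_pin_one w s(s, t) ((⋃ u ∈ (↑S : Set V), (openConn u b : Set (BondConfig V)))ᶜ
        ∩ (openConn b c : Set (BondConfig V))ᶜ)
    have eC := real_eq_pin_zero_add_pin_one w s(s, t) ((⋃ u ∈ (↑S : Set V), (openConn u c : Set (BondConfig V)))ᶜ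
        ∩ (openConn b c : Set (BondConfig V))ᶜ)
    rw [pin_one_U w S hs ht b c] at eU
    rw [pin_one_A w S hs ht b c] at eA
    rw [pin_one_B w S hs ht b c] at eB
    rw [pin_one_C w S hs ht b c] at eC
    rw [← hw0] at eU eA eB eC
    rw [eU, eA, eB, eC]
    -- nonnegativity / monotonicity of the endpoint values
    have subU : ((⋃ u ∈ insert t (↑S : Set V), (openConn u b : Set (BondConfig V)))ᶜ
        ∩ (⋃ u ∈ insert t (↑S : Set V), (openConn u c : Set (BondConfig V)))ᶜ ∩ (openConn b c : Set (BondConfig V))ᶜ) ⊆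
        ((⋃ u ∈ (↑S : Set V), (openConn u b : Set (BondConfig V)))ᶜ
        ∩ (⋃ u ∈ (↑S : Set V), (openConn u c : Set (BondConfig V)))ᶜ ∩ (openConn b c : Set (BondConfig V))ᶜ) := by
      intro ω hω
      simp only [mem_inter_iff, mem_compl_iff, mem_iUnion, exists_prop, not_exists, not_and] at hω ⊢
      exact ⟨⟨fun u hu => hω.1.1 u (mem_insert_of_mem _ hu), fun u hu => hω.1.2 u (mem_insert_of_mem _ hu)⟩, hω.2⟩
    have subB : ((⋃ u ∈ insert t (↑S : Set V), (openConn u b : Set (BondConfig V)))ᶜ ∩ (openConn b c : Set (BondConfig V))ᶜ) ⊆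
        ((⋃ u ∈ (↑S : Set V), (openConn u b : Set (BondConfig V)))ᶜ ∩ (openConn b c : Set (BondConfig V))ᶜ) := by
      intro ω hω
      simp only [mem_inter_iff, mem_compl_iff, mem_iUnion, exists_prop, not_exists, not_and] at hω ⊢
      exact ⟨fun u hu => hω.1 u (mem_insert_of_mem _ hu), hω.2⟩
    have subC : ((⋃ u ∈ insert t (↑S : Set V), (openConn u c : Set (BondConfig V)))ᶜ ∩ (openConn b c : Set (BondConfig V))ᶜ) ⊆
        ((⋃ u ∈ (↑S : Set V), (openConn u c : Set (BondConfig V)))ᶜ ∩ (openConn b c : Set (BondConfig V))ᶜ) := by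
      intro ω hω
      simp only [mem_inter_iff, mem_compl_iff, mem_iUnion, exists_prop, not_exists, not_and] at hω ⊢
      exact ⟨fun u hu => hω.1 u (mem_insert_of_mem _ hu), hω.2⟩
    have key := profile_edge_mixture
      ((prodBernoulli w0).real ((⋃ u ∈ (↑S : Set V), (openConn u b : Set (BondConfig V)))ᶜ
        ∩ (⋃ u ∈ (↑S : Set V), (openConn u c : Set (BondConfig V)))ᶜ ∩ (openConn b c : Set (BondConfig V))ᶜ))
      ((prodBernoulli w0).real ((⋃ u ∈ insert t (↑S : Set V), (openConn u b : Set (BondConfig V)))ᶜ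
        ∩ (⋃ u ∈ insert t (↑S : Set V), (openConn u c : Set (BondConfig V)))ᶜ ∩ (openConn b c : Set (BondConfig V))ᶜ))
      ((prodBernoulli w0).real ((⋃ u ∈ (↑S : Set V), (openConn u b : Set (BondConfig V)))ᶜ
        ∩ (⋃ u ∈ (↑S : Set V), (openConn u c : Set (BondConfig V)))ᶜ))
      ((prodBernoulli w0).real ((⋃ u ∈ insert t (↑S : Set V), (openConn u b : Set (BondConfig V)))ᶜ
        ∩ (⋃ u ∈ insert t (↑S : Set V), (openConn u c : Set (BondConfig V)))ᶜ))
      ((prodBernoulli w0).real ((⋃ u ∈ (↑S : Set V), (openConn u b : Set (BondConfig V)))ᶜ ∩ (openConn b c : Set (BondConfig V))ᶜ))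
      ((prodBernoulli w0).real ((⋃ u ∈ insert t (↑S : Set V), (openConn u b : Set (BondConfig V)))ᶜ ∩ (openConn b c : Set (BondConfig V))ᶜ))
      ((prodBernoulli w0).real ((⋃ u ∈ (↑S : Set V), (openConn u c : Set (BondConfig V)))ᶜ ∩ (openConn b c : Set (BondConfig V))ᶜ))
      ((prodBernoulli w0).real ((⋃ u ∈ insert t (↑S : Set V), (openConn u c : Set (BondConfig V)))ᶜ ∩ (openConn b c : Set (BondConfig V))ᶜ))
      measureReal_nonneg (measureReal_mono subU) measureReal_nonneg measureReal_nonneg measureReal_nonneg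
      (measureReal_mono subB) measureReal_nonneg (measureReal_mono subC) IH0 IH1 (rowPi_glued w0 S t b c)
      (w s(s, t) : ℝ) ⟨(w s(s, t)).2.1, (w s(s, t)).2.2⟩
    exact (key.trans_eq (by ring)).trans_eq' (by ring)
  · -- (2) no live pair leaves `S`: the glued set is a.s. isolated
    push Not at hlive
    have hnull : ∀ x, x ∉ S → (prodBernoulli w).real (⋃ u ∈ (↑S : Set V), (openConn u x : Set (BondConfig V))) = 0 := by
      intro x hx
      have hsub : (⋃ u ∈ (↑S : Set V), (openConn u x : Set (BondConfig V))) ⊆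
          {ω : BondConfig V | ∃ i ∈ (Finset.univ.filter fun f : Sym2 V => ∃ s ∈ S, ∃ t, t ∉ S ∧ f = s(s, t)), i ∈ ω} := by
        intro ω hω
        simp only [mem_iUnion, exists_prop] at hω
        obtain ⟨u, hu, hux⟩ := hω
        obtain ⟨s, hs, t, htS, hst⟩ := exists_crossing_of_setConn (S := (↑S : Set V)) (fun h => hx (Finset.mem_coe.1 h)) ⟨u, hu, hux⟩
        exact ⟨s(s, t), Finset.mem_filter.2 ⟨Finset.mem_univ _, s, Finset.mem_coe.1 hs, t, fun h => htS (Finset.mem_coe.2 h), rfl⟩, hst⟩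
      have hle := (measureReal_mono hsub).trans (prodBernoulli_real_exists_mem_le_sum w _)
      have hsum : ∑ i ∈ (Finset.univ.filter fun f : Sym2 V => ∃ s ∈ S, ∃ t, t ∉ S ∧ f = s(s, t)), (w i : ℝ) = 0 := by
        refine Finset.sum_eq_zero fun i hi => ?_
        obtain ⟨s, hs, t, ht, rfl⟩ := (Finset.mem_filter.1 hi).2
        exact le_antisymm (hlive s hs t ht) (w s(s, t)).2.1
      rw [hsum] at hle
      exact le_antisymm hle measureReal_nonneg
    have nb : (prodBernoulli w) (⋃ u ∈ (↑S : Set V), (openConn u b : Set (BondConfig V))) = 0 :=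
      (measureReal_eq_zero_iff (measure_ne_top _ _)).1 (hnull b hbS)
    have nc : (prodBernoulli w) (⋃ u ∈ (↑S : Set V), (openConn u c : Set (BondConfig V))) = 0 :=
      (measureReal_eq_zero_iff (measure_ne_top _ _)).1 (hnull c hcS)
    have nbc := measure_union_null nb nc
    -- every event below differs from its `S = ∅` version by a subset of the null set `{S~b} ∪ {S~c}`
    have hU : (prodBernoulli w).real ((⋃ u ∈ (↑S : Set V), (openConn u b : Set (BondConfig V)))ᶜ
        ∩ (⋃ u ∈ (↑S : Set V), (openConn u c : Set (BondConfig V)))ᶜ ∩ (openConn b c : Set (BondConfig V))ᶜ) =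
        (prodBernoulli w).real ((openConn b c : Set (BondConfig V))ᶜ) := by
      refine measureReal_congr (ae_eq_set.2 ⟨measure_mono_null (fun ω h => (h.2 h.1.2).elim) measure_empty,
        measure_mono_null (fun ω h => ?_) nbc⟩)
      by_contra hω
      simp only [mem_union, not_or] at hω
      exact h.2 ⟨⟨hω.1, hω.2⟩, h.1⟩
    have hA : (prodBernoulli w).real ((⋃ u ∈ (↑S : Set V), (openConn u b : Set (BondConfig V)))ᶜ
        ∩ (⋃ u ∈ (↑S : Set V), (openConn u c : Set (BondConfig V)))ᶜ) = 1 := by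
      rw [← probReal_univ (μ := prodBernoulli w)]
      refine measureReal_congr (ae_eq_set.2 ⟨measure_mono_null (fun ω h => (h.2 (mem_univ ω)).elim) measure_empty,
        measure_mono_null (fun ω h => ?_) nbc⟩)
      by_contra hω
      simp only [mem_union, not_or] at hω
      exact h.2 ⟨hω.1, hω.2⟩
    have hB : (prodBernoulli w).real ((⋃ u ∈ (↑S : Set V), (openConn u b : Set (BondConfig V)))ᶜ
        ∩ (openConn b c : Set (BondConfig V))ᶜ) = (prodBernoulli w).real ((openConn b c : Set (BondConfig V))ᶜ) := by
      refine measureReal_congr (ae_eq_set.2 ⟨measure_mono_null (fun ω h => (h.2 h.1.2).elim) measure_empty,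
        measure_mono_null (fun ω h => ?_) nbc⟩)
      by_contra hω
      simp only [mem_union, not_or] at hω
      exact h.2 ⟨hω.1, h.1⟩
    have hC : (prodBernoulli w).real ((⋃ u ∈ (↑S : Set V), (openConn u c : Set (BondConfig V)))ᶜ
        ∩ (openConn b c : Set (BondConfig V))ᶜ) = (prodBernoulli w).real ((openConn b c : Set (BondConfig V))ᶜ) := by
      refine measureReal_congr (ae_eq_set.2 ⟨measure_mono_null (fun ω h => (h.2 h.1.2).elim) measure_empty,
        measure_mono_null (fun ω h => ?_) nbc⟩)
      by_contra hω
      simp only [mem_union, not_or] at hω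
      exact h.2 ⟨hω.2, h.1⟩
    rw [hU, hA, hB, hC]
    nlinarith [pow_nonneg (measureReal_nonneg (μ := prodBernoulli w) (s := (openConn b c : Set (BondConfig V))ᶜ)) 6]

/-! ### The theorems -/

/-- **APL-P (the PROFILE row of gen 31) FOR EVERY FINITE WEIGHTED GRAPH** (memo THEOREM 1):
`μ(a|b|c)⁶ ≤ μ(a∤bc)² · μ(b∤ac)³ · μ(c∤ab)³`, i.e. `P(a|b|c)³ ≤ P(a∤bc)·(P(b∤ac)·P(c∤ab))^{3/2}`. [this work] -/
theorem profile_all (w : Sym2 V → unitInterval) (a b c : V) :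
    (prodBernoulli w).real ((openConn a b)ᶜ ∩ (openConn a c)ᶜ ∩ (openConn b c)ᶜ : Set (BondConfig V)) ^ 6 ≤
      (prodBernoulli w).real ((openConn a b)ᶜ ∩ (openConn a c)ᶜ : Set (BondConfig V)) ^ 2 *
        (prodBernoulli w).real ((openConn a b)ᶜ ∩ (openConn b c)ᶜ : Set (BondConfig V)) ^ 3 *
        (prodBernoulli w).real ((openConn a c)ᶜ ∩ (openConn b c)ᶜ : Set (BondConfig V)) ^ 3 := by
  have h := profile_glued b c _ w ({a} : Finset V) rfl
  simp only [Finset.coe_singleton, biUnion_singleton] at h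
  exact h

/-- `μ(c∤ab) = μ(a|b|c) + μ(ab|c)`. [folklore] -/
theorem isoC_split (w : Sym2 V → unitInterval) (a b c : V) :
    (prodBernoulli w).real ((openConn a c)ᶜ ∩ (openConn b c)ᶜ : Set (BondConfig V)) =
      (prodBernoulli w).real ((openConn a b)ᶜ ∩ (openConn a c)ᶜ ∩ (openConn b c)ᶜ : Set (BondConfig V)) +
        (prodBernoulli w).real (openConn a b ∩ (openConn a c)ᶜ : Set (BondConfig V)) := by
  have h := ClusterCovTransfer.real_eq_inter_add_inter_compl w ((openConn a c)ᶜ ∩ (openConn b c)ᶜ : Set (BondConfig V))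
    (openConn a b : Set (BondConfig V))
  have e1 : ((openConn a c)ᶜ ∩ (openConn b c)ᶜ : Set (BondConfig V)) ∩ (openConn a b : Set (BondConfig V)) =
      (openConn a b ∩ (openConn a c)ᶜ : Set (BondConfig V)) := by
    ext ω
    simp only [mem_inter_iff, mem_compl_iff]
    constructor
    · rintro ⟨⟨hac, _⟩, hab⟩; exact ⟨hab, hac⟩
    · rintro ⟨hab, hac⟩
      exact ⟨⟨hac, fun hbc => hac (SimpleGraph.Reachable.trans hab hbc)⟩, hab⟩
  have e2 : ((openConn a c)ᶜ ∩ (openConn b c)ᶜ : Set (BondConfig V)) ∩ (openConn a b : Set (BondConfig V))ᶜ =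
      ((openConn a b)ᶜ ∩ (openConn a c)ᶜ ∩ (openConn b c)ᶜ : Set (BondConfig V)) := by
    ext ω; simp only [mem_inter_iff, mem_compl_iff]; tauto
  rw [e1, e2] at h
  linarith

/-- `μ(b∤ac) = μ(a|b|c) + μ(ac|b)`. [folklore] -/
theorem isoB_split (w : Sym2 V → unitInterval) (a b c : V) :
    (prodBernoulli w).real ((openConn a b)ᶜ ∩ (openConn b c)ᶜ : Set (BondConfig V)) =
      (prodBernoulli w).real ((openConn a b)ᶜ ∩ (openConn a c)ᶜ ∩ (openConn b c)ᶜ : Set (BondConfig V)) +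
        (prodBernoulli w).real (openConn a c ∩ (openConn a b)ᶜ : Set (BondConfig V)) := by
  have h := ClusterCovTransfer.real_eq_inter_add_inter_compl w ((openConn a b)ᶜ ∩ (openConn b c)ᶜ : Set (BondConfig V))
    (openConn a c : Set (BondConfig V))
  have e1 : ((openConn a b)ᶜ ∩ (openConn b c)ᶜ : Set (BondConfig V)) ∩ (openConn a c : Set (BondConfig V)) =
      (openConn a c ∩ (openConn a b)ᶜ : Set (BondConfig V)) := by
    ext ω
    simp only [mem_inter_iff, mem_compl_iff]
    constructor
    · rintro ⟨⟨hab, _⟩, hac⟩; exact ⟨hac, hab⟩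
    · rintro ⟨hac, hab⟩
      refine ⟨⟨hab, fun hbc => hab ?_⟩, hac⟩
      exact SimpleGraph.Reachable.trans hac (SimpleGraph.Reachable.symm hbc)
  have e2 : ((openConn a b)ᶜ ∩ (openConn b c)ᶜ : Set (BondConfig V)) ∩ (openConn a c : Set (BondConfig V))ᶜ =
      ((openConn a b)ᶜ ∩ (openConn a c)ᶜ ∩ (openConn b c)ᶜ : Set (BondConfig V)) := by
    ext ω; simp only [mem_inter_iff, mem_compl_iff]; tauto
  rw [e1, e2] at h
  linarith

/-- `μ(a∤bc) = μ(a|b|c) + μ(a|bc)`. [folklore] -/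
theorem isoA_split (w : Sym2 V → unitInterval) (a b c : V) :
    (prodBernoulli w).real ((openConn a b)ᶜ ∩ (openConn a c)ᶜ : Set (BondConfig V)) =
      (prodBernoulli w).real ((openConn a b)ᶜ ∩ (openConn a c)ᶜ ∩ (openConn b c)ᶜ : Set (BondConfig V)) +
        (prodBernoulli w).real ((openConn a b)ᶜ ∩ (openConn a c)ᶜ ∩ openConn b c : Set (BondConfig V)) := by
  have h := ClusterCovTransfer.real_eq_inter_add_inter_compl w ((openConn a b)ᶜ ∩ (openConn a c)ᶜ : Set (BondConfig V))
    (openConn b c : Set (BondConfig V))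
  linarith

/-- **APL(2/3) FOR EVERY FINITE WEIGHTED GRAPH** (memo COROLLARY 2; the conjecture of the APL lane with the sharp constant).  In cells
`u0 = μ(a|b|c)`, `uab = μ(ab|c)`, `uac = μ(ac|b)`, `u3 = μ(a↔b ∧ a↔c)`:  `2·(u0+uab+uac)·(uab+uac+u3) ≤ 3·(uab+uac)`, i.e.
`2·μ(b↮c)·μ(a↔b ∨ a↔c) ≤ 3·μ(a joined to exactly one of b, c)`. [this work] -/
theorem apl23_all (w : Sym2 V → unitInterval) (a b c : V) :
    2 * (((prodBernoulli w).real ((openConn a b)ᶜ ∩ (openConn a c)ᶜ ∩ (openConn b c)ᶜ : Set (BondConfig V))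
        + (prodBernoulli w).real (openConn a b ∩ (openConn a c)ᶜ : Set (BondConfig V))
        + (prodBernoulli w).real (openConn a c ∩ (openConn a b)ᶜ : Set (BondConfig V))) *
      ((prodBernoulli w).real (openConn a b ∩ (openConn a c)ᶜ : Set (BondConfig V))
        + (prodBernoulli w).real (openConn a c ∩ (openConn a b)ᶜ : Set (BondConfig V))
        + (prodBernoulli w).real (openConn a b ∩ openConn a c : Set (BondConfig V)))) ≤
    3 * ((prodBernoulli w).real (openConn a b ∩ (openConn a c)ᶜ : Set (BondConfig V))
        + (prodBernoulli w).real (openConn a c ∩ (openConn a b)ᶜ : Set (BondConfig V))) := by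
  have hP := profile_all w a b c
  rw [isoA_split, isoB_split, isoC_split] at hP
  refine apl23_of_profile_cells _ _ _ _ _ measureReal_nonneg measureReal_nonneg measureReal_nonneg measureReal_nonneg
    (prodBernoulli_cells_sum_eq_one w a b c) ?_
  exact (hP.trans_eq (by ring))

/-- **APL₁(2/3) for every finite weighted graph**: `(2/3)·μ(a|b|c)·μ(a↔b ∧ a↔c) ≤ μ(ab|c) + μ(ac|b)` — in particular the three
APL₁(3/10) hypotheses of `ThreePort.pocketExchange_of_apl` hold on every finite weighted graph. [this work] -/
theorem apl1_twoThirds_all (w : Sym2 V → unitInterval) (a b c : V) :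
    2 / 3 * (prodBernoulli w).real ((openConn a b)ᶜ ∩ (openConn a c)ᶜ ∩ (openConn b c)ᶜ : Set (BondConfig V)) *
        (prodBernoulli w).real (openConn a b ∩ openConn a c : Set (BondConfig V)) ≤
      (prodBernoulli w).real (openConn a b ∩ (openConn a c)ᶜ : Set (BondConfig V))
        + (prodBernoulli w).real (openConn a c ∩ (openConn a b)ᶜ : Set (BondConfig V)) := by
  have h := apl23_all w a b c
  have h0 : 0 ≤ (prodBernoulli w).real ((openConn a b)ᶜ ∩ (openConn a c)ᶜ ∩ (openConn b c)ᶜ : Set (BondConfig V)) :=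
    measureReal_nonneg
  have h1 : 0 ≤ (prodBernoulli w).real (openConn a b ∩ (openConn a c)ᶜ : Set (BondConfig V)) := measureReal_nonneg
  have h2 : 0 ≤ (prodBernoulli w).real (openConn a c ∩ (openConn a b)ᶜ : Set (BondConfig V)) := measureReal_nonneg
  have h3 : 0 ≤ (prodBernoulli w).real (openConn a b ∩ openConn a c : Set (BondConfig V)) := measureReal_nonneg
  nlinarith [mul_nonneg h0 h3, mul_nonneg h1 h1, mul_nonneg h1 h2, mul_nonneg h2 h2, mul_nonneg h0 h1, mul_nonneg h0 h2,
    mul_nonneg h3 h1, mul_nonneg h3 h2]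

end APL

end Summit.CriticalPhenomena.PercolationContinuityZ3.Theorems

end
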